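import Summits.BirchSwinnertonDyer.Rank1Residual.O6.ShaGrowthDictionary
import Summits.BirchSwinnertonDyer.Rank1Residual.O6.KuriharaPollackWildThree
import Literature.NumberTheory.EllipticCurves.Kato2004.Condition1252
import Literature.NumberTheory.EllipticCurves.FormalGroup
import HarnessLib

/-!
# BSD rank-≤1 residual cell, class O6 (WILD `p = 3`), Iwasawa side: o6-r1 GEN 16 — LEMMA A `IntegralLogAdditive`
# (THEOREM-CANDIDATE node over the tree's `formalLog`), the local index exponent `i_n`, the KATO LOCAL INDEX `e_n^{an}`
# along `k_n = ℚ(ζ_{3^{n+1}})⁺` with the index identity (★) as a THEOREM over named inputs, and T-O6-G16 (i) (ii) (iii)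
# — Kato's upper bound / the tower descent of KMC₃ / its converse — as EVIDENCE-labelled nodes over the tree's
# `selmerLayer`; PROVED: `e_n^{an}` IS the `e` of the Ш-growth dictionary, hence obeys law (G) under STAB + (F)(D)(C)

HONEST FRAMING (cell `b2b-bsdres`, run/shared/lean/b2b/bsd-rank1-residual/, verbatim in every file): the goal of
the cell is to DELETE the COMBINATION-SHAPED residual classes of the Birch–Swinnerton-Dyer formula for ALL
analytic-rank `≤ 1` elliptic curves over `ℚ` — assembled STRICTLY from published theorems — so that the rank-`≤ 1`
remainder becomes exactly the CONSTRUCTION-SHAPED classes, which are TYPED (missing-input `Prop`s), NOT attempted.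
This is not "finishing BSD". Lane CLASS-CLOSURE (`CLASS-CLOSURE-PLAN.md` §3.4 O6, deliverables (a)/(b): statement
discovery with validation; the verbatim-extension part handed to provers with its statement): research routes; no
claim beyond the stated classes; census output is EVIDENCE, never a Literature fact; Kato's main conjecture KMC₃ enters
ONLY as the slot-1 interface `KMC` (a section variable, as in `O6/O6Targets.lean`), never as a fact; nothing is booked;
no mark of `RESIDUAL-MAP.md` moves; O6 stays OPEN. Closed unproved `def : Prop` nodes carry `@[conjecture]` whatever the
docstring grade (cc-lead ⟦gen22⟧ (8)(b)). 0 Literature facts are minted here.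

## What is typed (cc-typer-5 GEN 11 = O5/O6 typer of record; asks (T1)/(T2) of o6-r1 GEN 16, `HOME/INBOX.md`
## 2026-08-22T01:32Z / 01:42Z and `cells/o5o6/TARGETS.md` §O6 'o6-r1 GEN 16' (G16-1)–(G16-7); content = memo of record
## `HOME/b2b-bsdres-o6-r1/gen16/O6-GEN16.md` §0–§2, §6.2; instruments C-O6-MW v2/v2.1 `gen16/mw/c_o6_mw21.py` (kit j144989,
## j144687, j144689, j144798, j144809), `gen15/kur/bsd3_isl_k6_v15.txt`; placement / names / interface shape / dedup = typer)

SETTING (memo §1–§2). `W ∈ O6`, `K = k_{n,𝔭}` the completion at `𝔭 ∣ 3` of the `n`-th cyclotomic layer (`[K : ℚ₃] = 3^n`,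
totally ramified), `Λ_n = ℤ₃[G_n]`, `𝓜_n := log_{ω_ℚ}(W(K)) ⊗ ℤ₃ ⊂ K`, `i_n := ord₃[𝓜_n : 𝔪_K] = d_n + ord₃[W(K) :
W₁^{min}(K)] − t_n` (`t_n = ord₃ #W(K)[3^∞]`), `ν(W,χ) := ord₃(τ(χ̄)L(W,χ,1)/Ω_W)` for `χ ∈ Ĝ_n` (the sibling files' `ν⁺_k =
D.nu k true` for the `φ(3^k)` characters of conductor `3^{k+1}`, `k ≥ 1`, and `ν₀ := ν(W,1)`), `z_n` Kato's zeta element.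

* §1 (T1) **LEMMA A `IntegralLogAdditive`** (↦ THEOREM: `O6.integralLogAdditive_holds`, n1011-p05 p326601, `O6/IntegralLogAdditiveHolds.lean`;
  formerly THEOREM-CANDIDATE `@[conjecture]`; stated over the tree's `WeierstrassCurve.formalLog`,
  Literature `FormalGroup.lean`): for `W/ℚ` globally minimal, ADDITIVE at an odd prime `p`, every coefficient of the formal
  logarithm of `W ⊗ ℚ_p` lies in `ℤ_p` (memo §1: "additive ⇒ `Ĝ_a`"; two proofs printed there: `[p]_F ≡ 0 (mod p)` since the
  reduction of `F` is the formal group of `Ẽ_ns ≅ 𝔾_a`; or Honda `a_p = 0`). Not provable in the kernel today: the tree has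
  `formalLog` over `ℚ`-algebras but NOT the formal group law / `[p]`-series over `ℤ_p` (module doc of `FormalGroup.lean`:
  "What is NOT delivered"), nor Honda theory — hence a node, handed to provers. Its corollaries (a) `log_ω : W₁^ℚ(K) ⥲ 𝔪_K`,
  (b) `W₁^ℚ(K) = W^{min}_{d_K+1}(K)`, (d) `exp* H¹_{/f} = 𝓜_K^⊥` need points / depth filtrations over the layer fields (no
  tree vocabulary) and are recorded in the docstring; (c) the INDEX is typed at OUTPUT level as the exponent
  `LocalTowerDatum.indexExpAt` (`i_n = d_n + 1 + ord₃ c_n − t_n` on additive layers, `d_n + ord₃ #W̃(𝔽_𝔭) − t_n` on good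
  "exit" layers) — `AdditiveLocalPointsIndex` in o6-r1's wording.
* §2 (T2) **THE KATO LOCAL INDEX**: `charSumNu ν₀ ν n = ν₀ + Σ_{k=1}^{n} φ(3^k)·ν_k` (`= Σ_{χ ∈ Ĝ_n} ν(W,χ)` grouped by
  conductor: `1 + Σ_{k≤n} φ(3^k) = 3^n = #Ĝ_n`, PROVED), `katoLocalIndexAn ν₀ ν T t n := charSumNu − i_n + 1 = e_n^{an}`;
  **the index identity (★) `katoLocalIndex_identity` as a THEOREM over its three NAMED inputs** (Lemma B group-determinant
  `ord₃[𝔄 : Λ_n a] = Σ_χ ord₃(a|χ) − ½ ord₃ disc 𝔄`; Lemma A (d) `disc 𝓜_n^⊥ = 3^{−(2 + δ_n − 2 i_n)}`; Kato 12.5 (1) +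
  conductor–discriminant `Σ_χ ord₃(a_n|χ) = Σ_χ ν(W,χ) − δ_n/2`) ⟹ `e_n^{an} = Σ_χ ν(W,χ) + 1 − i_n` — linear bookkeeping,
  nothing asserted about the inputs; PROVED `katoLocalIndexAn_step`: `e_n^{an} − e_{n−1}^{an} = φ(3^n)ν_n − Δd_n − Δord₃c_n +
  Δt_n` (`n ≥ 1`, additive layers) — so **`e^{an}` satisfies `ThreeBSDTowerBookkeeping`** (`O6/ShaGrowthDictionary.lean`) with
  `r = 0` when `t ≡ 0` (`threeBSDTowerBookkeeping_katoLocalIndexAn`): memo §2.4 "numerically the SAME quantity as gen 14/15's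
  3-BSD bookkeeping `S_k`", now a kernel identity.
* §3 (T2) **T-O6-G16 as nodes over the tree's `W.selmerLayer κ n`** (`= Sel_{3^∞}(W/k_n)`; `κ` the cyclotomic `ℤ₃`-extension):
  (i) `KatoTowerUpperBoundThree` (THEOREM-CANDIDATE from Kato 12.4 + 12.5 (4), NO main conjecture): on CORE rows
  ((12.5.2) `Kato2004.ImageContainsSL2 W 3`, H2, H3, NV_n) `#Sel_{3^∞}(W/k_n) = 3^m` with `m ≤ e_n^{an}`; (ii)
  `TowerDescentOfKMCThree KMC` : KMC₃ ⟹ `#Sel_{3^∞}(W/k_n) = 3^{e_n^{an}}` for every `n` with NV_n (= BSD₃(`W/k_n`), rank 0);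
  (iii) `KMCOfTowerBSDThree KMC`: equality for all large `n` ⟹ KMC₃. EVIDENCE: C-O6-G16-SQ island 1 376 + 319 increments
  `0` odd / `0` negative, KF5 held-out 276/276. And the PROVED payoff `shaGrowthLaw_of_towerDescent`: (ii) + STAB + (F)(D)(C)
  ⟹ `ord₃ #Sel_{3^∞}(W/k_n)` obeys law (G) with `α = ℓ(τ) − v₃(Δ_min)/12` (via `shaGrowthLaw_of_stability_of_towerLaws`).

NOT typed: the exit-row Euler factor `(4 − a_𝔭)/3` as a law (only the `indexExpAt` branch); TORS rows (H3 failing: `H⁰`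
terms "left to the typer/prover" — a later item, first test row 1701g1); C-O6-G16-EQ (instrument want I-O6-SHA-K1, census);
R-O6-LOC″ / LEMMA C (§4: offered to o6-r2; `LocalPointsModuleDatum` of `O6/KuriharaPollackWildThree.lean` is its interface home;
a `Q_n`-column extension is a successor item on o6-r1/o6-r2's word). DEDUP (`lean search` / tree grep: `IntegralLogAdditive`,
`indexExpAt`, `charSumNu`, `katoLocalIndexAn`, `katoLocalIndex_identity`, `KatoTowerUpperBoundThree`, `TowerDescentOfKMCThree`,
`KMCOfTowerBSDThree`, `IsLevelZeroValuationThree`): no match. Reused by name: `formalLog` (Literature `FormalGroup.lean`),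
`Kato2004.ImageContainsSL2` (`Condition1252.lean`), `entireLFunction`, `realPeriodRat`, `selmerLayer`, `ZpExtension.IsCyclotomic`,
`LocalTowerDatum` (+ `dAt`, `tamOrdAt`), `SignedFloorDatum`, `phiThree`, `ThreeBSDTowerBookkeeping`,
`shaGrowthLaw_of_stability_of_towerLaws`, the three tower laws, STAB, `KPHypothesesThree`, `NoRationalThreeTorsionOverQ3`.

References: K. Kato, Astérisque 295 (2004) Thm. 12.4, Thm. 12.5 (1)/(4) with (12.5.2) (pp. 221–222), Conj. 12.10 (p. 224)
[Kato2004Asterisque]; R. Pollack, J. Number Theory 110 (2005) §2 [Pollack2005]; J. Silverman, AEC IV.4–IV.6 (formal logarithm)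
[SilvermanAEC2009]; M. Kosters, R. Pannekoek, arXiv:1703.07888 Thm. 1 / Thm. 3 (unramified / `6e < p − 1`; the ramified case
left open, p. 3, p. 8) — prose cite, no bib key; C.-H. Kim, arXiv:1808.07726 Thm. 2.1 / Cor. 2.4 — prose; T. Honda, Osaka J. Math.
5 (1968) Thm. 5 — prose; A. Fröhlich (resolvent / discriminant identity) — prose; census: o6-r1 GEN 16 memo §2.4, §3.
-/

set_option autoImplicit false

noncomputable section

open scoped Classical

open WeierstrassCurve Literature.NumberTheory.EllipticCurves
  Literature.NumberTheory.EllipticCurves.Rank1Residual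
  Literature.NumberTheory.EllipticCurves.Rank1Residual.Typed
  Summit.BirchSwinnertonDyer.Rank1Residual.Additive

namespace Summit.BirchSwinnertonDyer.Rank1Residual.O6

/-! ## §1 (T1) LEMMA A `IntegralLogAdditive` and the local index exponent `i_n` -/

/-- **LEMMA A `IntegralLogAdditive` — "additive ⇒ `Ĝ_a`: the `ℚ_p`-minimal formal group has integral logarithm"
(o6-r1 GEN 16 memo §1).  ↦ THEOREM (restamp cc-typer-5 GEN 15, 2026-08-22): PROVED in the kernel as
`O6.integralLogAdditive_holds : IntegralLogAdditive` — n1011-p05 GEN 13, ROW T-O6-LOGA, `O6/IntegralLogAdditiveHolds.lean`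
(p326601 ACCEPTED 1d7a287791e3; via `Additive.norm_coeff_formalLog_baseChange_le_one_of_addv`, valid at EVERY additive prime,
`p = 2` included, with `[p]˜ = 0` and `exp_W ∈ ℤ_p⟦X⟧`; 0 facts); the `@[conjecture]` attribute is RETIRED, the statement bytes
are unchanged, consumers keep binding `(h : IntegralLogAdditive)` and are fed `integralLogAdditive_holds`.  Former status:
THEOREM-CANDIDATE with two printed-style proofs in the memo, EVIDENCE-labelled.** For `W/ℚ` globally minimal (hence `ℤ_p`-minimal) with ADDITIVE reduction at an odd prime `p`
(`Addv W p`): every coefficient of the formal logarithm `log_W = ∫ω ∈ ℚ_p⟦X⟧` of `W ⊗ ℚ_p` (the tree's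
`WeierstrassCurve.formalLog`, Silverman AEC IV.4–IV.5) has `p`-adic norm `≤ 1`, i.e. `log_W ∈ ℤ_p⟦X⟧` — equivalently the
formal group of `W` over `ℤ_p` is strictly isomorphic to `Ĝ_a`. PROOF 1 (memo, three lines): the reduction of the formal
group law `F` mod `p` is the formal group of `Ẽ_ns ≅ 𝔾_a`, killed by `p`, so `[p]_F = p·g` with `g ∈ ℤ_p⟦X⟧`, `g ≡ X
(mod deg 2)` invertible; from `log_F([p]_F X) = p·log_F X`, `log_F = h ∘ g` with `h(Y) = p⁻¹ log_F(pY) = Σ b_m p^{m−1}Y^m`,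
and `v_p(b_m) ≥ −v_p(m)`, `m − 1 ≥ v_p(m)` give `h ∈ ℤ_p⟦Y⟧`. PROOF 2 (Honda 1968 Thm. 5): `F` is strictly isomorphic over
`ℤ_(p)` to the law with logarithm `Σ a_n(W)X^n/n`; additive ⇒ `a_p = 0 ⇒ a_{p^k m} = 0`. (Integrality is invariant under the
`ℤ_p`-isomorphisms between minimal models, `u ∈ ℤ_p^×`.) WHY A NODE (STALE since p326601 — n1011-p05 proved it from the
MANIN-constant lane's `norm_coeff_formalLog_le_one_of_dvd_of_dvd` + Honda; kept for the record): the tree has `formalLog` over `ℚ`-algebras but neither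
the formal group LAW / `[p]`-series over `ℤ_p` nor Honda theory (`FormalGroup.lean`, "What is NOT delivered"). PLACEMENT
(o6-r1's presearch, both corpora): nearest print Kosters–Pannekoek arXiv:1703.07888 Thm 1 (unramified) / Thm 3 (`6e < p − 1`),
C.-H. Kim arXiv:1808.07726 Thm 2.1 / Cor 2.4 (`E₀`-level, unramified), B.D. Kim 2026 §3.2.3 (`K = ℚ₃`: `exp* H¹(ℚ₃,T) =
c₃3^{−t}ℤ₃`); the ramified case is the one K–P leave open; expected folklore ("one line from Honda"), no printed statement
found for ramified `K`. COROLLARIES (memo §1, any finite `K/ℚ_p`, recorded — no tree vocabulary over `K`): (a) `log_ω :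
W₁^ℚ(K) = F(𝔪_K) ⥲ 𝔪_K` a `ℤ_p[Gal]`-isomorphism; (b) `W₁^ℚ(K) = W^{min}_{d_K+1}(K)`; (c) `[𝓜_K : 𝔪_K] = p^{i_K}`,
`i_K = d_K + ord_p[W(K) : W₁^{min}(K)] − t_K` (typed as `LocalTowerDatum.indexExpAt`); (d) `exp*_ω(H¹(K,T)/H¹_f) = 𝓜_K^⊥`.
Why it might fail: it would contradict the 36/36 + 78/78 numerics and both proofs; a single additive minimal model with a
non-integral `log` coefficient refutes it.
[evidence: census cell O6, o6-r1 GEN 16 C-O6-MW v2.1 (kit j144989 all 35 reps + 27a1, n ≤ 2; j144687/j144689/j144798/j144809 n = 3): logint = min_m v₃(b_m) = 0 on 36/36 additive curves (< 0 on the 4 good calibration curves 11a1/17a1/37a1/…), containment 𝔪 ⊂ 𝓜^{min}_n and idx = d_n − t_n on 78/78 row-levels, gen-15 vL = 1 − idx on 78/78; 0 exceptions]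
[cite: SilvermanAEC2009, IV.4.2–IV.5.5 (ω, log_F) and IV.6.4] -/
def IntegralLogAdditive : Prop :=
  ∀ (W : WeierstrassCurve ℚ) [W.IsElliptic] [W.IsGloballyMinimal] (p : ℕ) [Fact p.Prime],
    p ≠ 2 → Addv W p → ∀ n : ℕ, ‖PowerSeries.coeff n (W.baseChange ℚ_[p]).formalLog‖ ≤ 1

/-- **Lemma A (c) at OUTPUT level — the local INDEX EXPONENT `i_n` along the tower** (`AdditiveLocalPointsIndex` in o6-r1's
wording): `i_n = ord₃[𝓜_n : 𝔪_{k_{n,𝔭}}] = d_n + ord₃[W(K) : W₁^{min}(K)] − t_n`, with `ord₃[W(K) : W₁^{min}(K)] = 1 +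
ord₃ c_n` on an ADDITIVE layer (`Ẽ_ns(𝔽₃) = 𝔽₃`, `f_n ≠ 0`) and `= ord₃ #W̃(𝔽_𝔭) = ord₃(4 − a_𝔭)` on a GOOD ("exit") layer
(`f_n = 0`; residue field `𝔽₃`, `#W̃(𝔽₃) = 4 − a_𝔭`, supplied as the parameter `exitOrd n`); `t n = ord₃ #W(k_{n,𝔭})[3^∞]`
(`= 0` under (H3)). A definition on the tower datum; the index THEOREM behind it is `IntegralLogAdditive` (c). [folklore] -/
def LocalTowerDatum.indexExpAt {W : WeierstrassCurve ℚ} [W.IsElliptic] [W.IsGloballyMinimal] (T : LocalTowerDatum W)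
    (t exitOrd : ℕ → ℕ) (n : ℕ) : ℚ :=
  T.dAt n + (if T.condExpAt n = 0 then (exitOrd n : ℚ) else 1 + (T.tamOrdAt n : ℚ)) - (t n : ℚ)

/-- On an additive (persistent) layer `i_n = d_n + 1 + ord₃ c_n − t_n`. [folklore] -/
theorem LocalTowerDatum.indexExpAt_of_ne_zero {W : WeierstrassCurve ℚ} [W.IsElliptic] [W.IsGloballyMinimal]
    (T : LocalTowerDatum W) (t exitOrd : ℕ → ℕ) (n : ℕ) (h : T.condExpAt n ≠ 0) :
    T.indexExpAt t exitOrd n = T.dAt n + 1 + (T.tamOrdAt n : ℚ) - (t n : ℚ) := by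
  simp only [LocalTowerDatum.indexExpAt, if_neg h]
  ring

/-! ## §2 (T2) The Kato local index `e_n^{an}` and the index identity (★) -/

/-- **`Σ_{χ ∈ Ĝ_n} ν(W,χ)` grouped by conductor**: `ν₀ + Σ_{k=1}^{n} φ(3^k)·ν_k` — the trivial character (`ν₀ = ν(W,1) =
ord₃(L(W,1)/Ω_W)`) plus, for each `k ≥ 1`, the `φ(3^k)` even primitive characters of conductor `3^{k+1}` with their common
valuation `ν_k = ν⁺_k` (`SignedFloorDatum.nu k true`). [folklore] -/
def charSumNu (ν₀ : ℚ) (ν : ℕ → ℚ) (n : ℕ) : ℚ :=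
  ν₀ + ∑ k ∈ Finset.Icc 1 n, (phiThree k : ℚ) * ν k

/-- `charSumNu` at `n = 0` is `ν₀`. [folklore] -/
theorem charSumNu_zero (ν₀ : ℚ) (ν : ℕ → ℚ) : charSumNu ν₀ ν 0 = ν₀ := by
  simp [charSumNu]

/-- The layer recursion: `charSumNu (n+1) = charSumNu n + φ(3^{n+1})·ν_{n+1}`. [folklore] -/
theorem charSumNu_succ (ν₀ : ℚ) (ν : ℕ → ℚ) (n : ℕ) :
    charSumNu ν₀ ν (n + 1) = charSumNu ν₀ ν n + (phiThree (n + 1) : ℚ) * ν (n + 1) := by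
  unfold charSumNu
  rw [Finset.sum_Icc_succ_top (by omega)]
  ring

/-- **The character count `#Ĝ_n = 3^n`**: `1 + Σ_{k=1}^{n} φ(3^k) = 3^n` (PROVED) — the grouping by conductor is exhaustive.
[folklore] -/
theorem one_add_sum_phiThree (n : ℕ) : 1 + ∑ k ∈ Finset.Icc 1 n, phiThree k = 3 ^ n := by
  induction n with
  | zero => simp
  | succ n ih =>
      rw [Finset.sum_Icc_succ_top (by omega), ← add_assoc, ih, phiThree, Nat.add_sub_cancel, pow_succ]
      ring

/-- **The KATO LOCAL INDEX `e_n^{an}(W) := Σ_{χ∈Ĝ_n} ν(W,χ) + 1 − i_n(W)`** (memo §2.2 (★); on a persistent CORE row `=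
Σ_χ ν(W,χ) − d_n − ord₃ c_n`, memo §2.4) — as a function of the census valuations `ν₀, ν_k`, the tower datum and the
torsion / exit parameters. It is ALSO `ord₃` of the BSD quotient of `W/k_n` in rank `0` under H2/H3 (memo §2.2 "BSD SIDE").
[folklore] -/
def katoLocalIndexAn {W : WeierstrassCurve ℚ} [W.IsElliptic] [W.IsGloballyMinimal] (ν₀ : ℚ) (ν : ℕ → ℚ)
    (T : LocalTowerDatum W) (t exitOrd : ℕ → ℕ) (n : ℕ) : ℚ :=
  charSumNu ν₀ ν n + 1 - T.indexExpAt t exitOrd n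

/-- **THE INDEX IDENTITY (★) as a theorem over its NAMED inputs (memo §2.1–2.2; Lemma B = Fröhlich's resolvent/discriminant
identity; nothing about the inputs is asserted here).** With `idx = ord₃[𝓜_n^⊥ : Λ_n a_n]` (`a_nω = exp*(loc_𝔭 z_n)`),
`sumRes = Σ_χ ord₃(a_n|χ)`, `discOrd = ord₃ disc(𝓜_n^⊥)`, `δ = ord₃ d_{k_n}`, `i = i_n`, `sumNu = Σ_χ ν(W,χ)`: Lemma B
`idx = sumRes − discOrd/2`, Lemma A (d) `discOrd = −(2 + δ − 2i)` (`disc 𝓜_n = disc(𝔪)·3^{−2i} = 3^{2+δ−2i}`), and Kato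
Thm 12.5 (1) + conductor–discriminant (`(a_n|χ) ≐ Λ(W,χ)/τ(χ̄)`, `Σ_χ ord₃ τ(χ̄) = δ/2`) `sumRes = sumNu − δ/2` give
**`idx = sumNu + 1 − i`** — the gluing term gen 15 feared is the discriminant of `𝓜_n`, and Lemma A computes it; NO
Galois-module structure enters the ORDER. [cite: Kato2004Asterisque, Thm. 12.5 (1) (p. 221)] -/
theorem katoLocalIndex_identity (idx sumRes discOrd δ i sumNu : ℚ)
    (hLemmaB : idx = sumRes - discOrd / 2) (hLemmaAd : discOrd = -(2 + δ - 2 * i))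
    (hKato : sumRes = sumNu - δ / 2) : idx = sumNu + 1 - i := by
  rw [hLemmaB, hLemmaAd, hKato]
  ring

/-- **PROVED layer step of `e^{an}` on additive layers**: if layers `n` and `n + 1` are additive (`f ≠ 0`), then
`e_{n+1}^{an} − e_n^{an} = φ(3^{n+1})·ν_{n+1} − (d_{n+1} − d_n) − (ord₃c_{n+1} − ord₃c_n) + (t_{n+1} − t_n)` — memo §2.4: "`e_n =
Σ_{k≤n} S_k` is numerically the SAME quantity as gen 14/15's 3-BSD bookkeeping". [folklore] -/
theorem katoLocalIndexAn_succ_sub {W : WeierstrassCurve ℚ} [W.IsElliptic] [W.IsGloballyMinimal] (ν₀ : ℚ) (ν : ℕ → ℚ)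
    (T : LocalTowerDatum W) (t exitOrd : ℕ → ℕ) (n : ℕ) (hn : T.condExpAt n ≠ 0) (hn1 : T.condExpAt (n + 1) ≠ 0) :
    katoLocalIndexAn ν₀ ν T t exitOrd (n + 1) - katoLocalIndexAn ν₀ ν T t exitOrd n =
      (phiThree (n + 1) : ℚ) * ν (n + 1) - (T.dAt (n + 1) - T.dAt n) -
        ((T.tamOrdAt (n + 1) : ℚ) - (T.tamOrdAt n : ℚ)) + ((t (n + 1) : ℚ) - (t n : ℚ)) := by
  simp only [katoLocalIndexAn, charSumNu_succ, T.indexExpAt_of_ne_zero t exitOrd n hn,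
    T.indexExpAt_of_ne_zero t exitOrd (n + 1) hn1]
  ring

/-- **`e^{an}` satisfies the 3-BSD TOWER BOOKKEEPING schema of `O6/ShaGrowthDictionary.lean` with `r = 0`** on a tail of
additive layers with no layer torsion (`t ≡ 0`, i.e. (H3)) and non-vanishing even character parts (NV): PROVED — so every
consequence of the dictionary (law (G) under STAB + (F)(D)(C)) applies to the Kato local index. [folklore] -/
theorem threeBSDTowerBookkeeping_katoLocalIndexAn {W : WeierstrassCurve ℚ} [W.IsElliptic] [W.IsGloballyMinimal]
    (ν₀ : ℚ) (ν : ℕ → ℚ) (D : SignedFloorDatum W) (T : LocalTowerDatum W) (exitOrd : ℕ → ℕ) (k₁ : ℕ) (hk₁ : 1 ≤ k₁)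
    (hadd : ∀ k, k₁ - 1 ≤ k → T.condExpAt k ≠ 0) (hNV : ∀ k, k₁ ≤ k → D.nu k true = some (ν k)) :
    ThreeBSDTowerBookkeeping (katoLocalIndexAn ν₀ ν T (fun _ => 0) exitOrd) ν D T 0 k₁ := by
  intro k hk
  refine ⟨hNV k hk, ?_⟩
  obtain ⟨m, rfl⟩ : ∃ m, k = m + 1 := ⟨k - 1, by omega⟩
  rw [Nat.add_sub_cancel]
  have h := katoLocalIndexAn_succ_sub ν₀ ν T (fun _ => 0) exitOrd m (hadd m (by omega)) (hadd (m + 1) (by omega))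
  simp only [Nat.cast_zero, sub_self, add_zero] at h
  linear_combination h

/-! ## §3 (T2) T-O6-G16 (i) (ii) (iii): Kato's bound, the tower descent of KMC₃, and its converse — nodes over `selmerLayer` -/

/-- **`ν₀` reads `ord₃(L(W,1)/Ω_W)`** (the trivial character's `ν(W,1)`; NV at `χ = 1`): `L(W,1)/Ω_W` (the tree's
`W.entireLFunction 1 / W.realPeriodRat`, as in Literature's `PPartRankZero`) is a NON-ZERO rational `q` with `ord₃ q = ν₀`.
A predicate; nothing asserted. [cite: Miller2011LMS, Def. 1.1] -/
def IsLevelZeroValuationThree (W : WeierstrassCurve ℚ) (ν₀ : ℤ) : Prop :=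
  ∃ q : ℚ, q ≠ 0 ∧ W.entireLFunction 1 / (W.realPeriodRat : ℂ) = (q : ℂ) ∧ padicValRat 3 q = ν₀

section TowerDescent

variable (KMC : ∀ (W : WeierstrassCurve ℚ) [W.IsElliptic] [W.IsGloballyMinimal] (p : ℕ), Prop)
variable (real : ∀ (W : WeierstrassCurve ℚ) [W.IsElliptic] [W.IsGloballyMinimal], SignedFloorDatum W → Prop)
variable (realT : ∀ (W : WeierstrassCurve ℚ) [W.IsElliptic] [W.IsGloballyMinimal], LocalTowerDatum W → Prop)

/-- **T-O6-G16 (i) `KatoTowerUpperBoundThree` — Kato's theorem along the tower (THEOREM-CANDIDATE from Kato Thm 12.4 + 12.5 (4)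
WITHOUT any main conjecture; `@[conjecture]` until a kernel proof; EVIDENCE-labelled).** For `W ∈ O6` on a CORE row —
(12.5.2) the image of `G_{ℚ(μ_{3^∞})}` in `Aut T₃W` contains `SL₂(ℤ₃)` (`Kato2004.ImageContainsSL2 W 3`), (H2) `3 ∤ c_ℓ` for
`ℓ ≠ 3` and `W(ℚ)[3] = 0`, (H3) `W(ℚ₃)[3] = 0`, data `D`, `T` realised, all layers `≥ 1` additive (persistent row), and at
level `n` (NV_n) `L(W,χ,1) ≠ 0` for every `χ ∈ Ĝ_n` (`ν₀` via `IsLevelZeroValuationThree`, the even parts `D.nu k true = some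
(ν k)` for `1 ≤ k ≤ n`): the `3^∞`-Selmer group of `W` over the layer `k_n` of the cyclotomic `ℤ₃`-extension (`W.selmerLayer κ
n`) is FINITE of order `3^m` with **`m ≤ e_n^{an}(W)`**. Route (memo §2.3): `𝐇²` torsion, `𝐇¹` free of rank 1 (12.4),
`Z(f,T) ⊂ 𝐇¹` and `char 𝐇² ∣ char 𝐇¹/Z` integrally under (12.5.2) (12.5 (4); (12.5.1) would need potentially multiplicative
reduction — O6 is potentially good), the descent diagram KP (Poitou–Tate relaxed at `𝔭`, `H¹_f(k_n,T) = 0`, KP-1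
Coates–Greenberg), and (★). In particular `Σ_χ ν(W,χ) ≥ i_n − 1 ≥ d_n` — the 3-adic integrality of `Ш_an(W/k_n)` whose main
term is the KL-c floor `v₃Δ/12`, now a consequence of Kato's theorem row by row, not a law. Why it might fail: a CORE row
with `#Sel_{3^∞}(W/k_n) > 3^{e_n^{an}}` — `e_n^{an} < 0` on a hypothesis-clean row already refutes Lemma A / (★) / KP.
[evidence: census cell O6, o6-r1 GEN 16 C-O6-G16-SQ: island 285 curves (gen15/kur/bsd3_isl_k6_v15.txt) 1 376 measured + 319 LPP-extrapolated clean increments S_k, 0 negative (and 0 odd); KF5 held-out (gen 14 P-BSD5, prereg f4a2ebf93dcf4080) 276/276 row-levels ≥ 0; the only negative entries are the 14 exit rows at k = 1 before the (4 − a_𝔭)/3 correction of `indexExpAt`]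
[cite: Kato2004Asterisque, Thm. 12.4 and Thm. 12.5 (4) with (12.5.2) (pp. 221–222)] [cite: CoatesGreenberg1996, §3 Cor. 3.2] -/
@[conjecture] def KatoTowerUpperBoundThree : Prop :=
  ∀ (W : WeierstrassCurve ℚ) [W.IsElliptic] [W.IsGloballyMinimal] (D : SignedFloorDatum W) (T : LocalTowerDatum W),
    ClassO6 W 3 → Kato2004.ImageContainsSL2 W 3 →
    (∀ (ℓ : ℕ) [Fact ℓ.Prime], ℓ ≠ 3 → ¬ 3 ∣ (W.baseChange ℚ_[ℓ]).localTamagawaNumber ℤ_[ℓ]) →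
    (∀ P : W.toAffine.Point, 3 • P = 0 → P = 0) → NoRationalThreeTorsionOverQ3 W →
    real W D → realT W T → (∀ k, 1 ≤ k → T.condExpAt k ≠ 0) →
      ∀ {κ : ZpExtension ℚ 3}, κ.IsCyclotomic → ∀ (ν₀ : ℤ) (ν : ℕ → ℚ) (exitOrd : ℕ → ℕ) (n : ℕ),
        IsLevelZeroValuationThree W ν₀ → (∀ k, 1 ≤ k → k ≤ n → D.nu k true = some (ν k)) →
          ∃ m e : ℕ, (e : ℚ) = katoLocalIndexAn (ν₀ : ℚ) ν T (fun _ => 0) exitOrd n ∧ m ≤ e ∧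
            Nat.card (W.selmerLayer κ n) = 3 ^ m

/-- **T-O6-G16 (ii) `TowerDescentOfKMCThree` — THE TOWER DESCENT OF KMC₃ (CONJECTURE-SHAPED: conditional on Kato's main
conjecture 12.10 = the slot-1 interface `KMC W 3`, NEVER a fact; EVIDENCE-labelled; the tower form (A0_n) of T-O6-A).** On a
CORE row as in (i), with (H1) `Sel₃(W/ℚ) = 0` anchoring level `0` (`KPHypothesesThree`): KMC₃(W) ⟹ for every `n` with NV_n,
**`#Sel_{3^∞}(W/k_n) = 3^{e_n^{an}(W)}`** — equality in (i); since `W(k_n)` is finite with no `3`-torsion under H1–H3 + NV_n this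
IS `ord₃ #Ш(W/k_n)[3^∞] = e_n^{an}` = the `3`-part of the BSD formula of `W/k_n` (rank 0) (memo §2.2–2.3: "(★) is
literally the 3-part of the BSD quotient over `k_n`", for all `n` and all O6 Kodaira types). TYPED HERE ON PERSISTENT ROWS
(every layer `≥ 1` additive — automatic for `f ∈ {3, 5}` by (F)); the EXIT rows (`f = 4`, `f_1 = 0`: good reduction over
`k_{1,𝔭}`) need the exit branch of `indexExpAt` with `exitOrd n` PINNED to `ord₃(4 − a_𝔭(W/k_{n,𝔭}))` — a column the tower
datum does not carry yet (successor item; here `exitOrd` is inert). So gen 15's local crux (L) is NOT load-bearing for `#Ш`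
(demoted to the `Λ_n`-STRUCTURE of `Ш`, `O6/KuriharaPollackWildThree.lean` §4). Why it might fail:
only with KMC₃(W) or an input of (i); the census falsifier is C-O6-G16-SQ (`e_n^{an}` EVEN and `≥ 0` by Cassels–Tate: an odd value on
a hypothesis-clean row is an ANOMALY against KMC₃(W) — anomaly protocol; planted control `c_𝔭 ↦ 3c_𝔭` flips every row).
[evidence: census cell O6, o6-r1 GEN 16 C-O6-G16-SQ: island 1 376 + 319 clean increments 0 odd / 0 negative; KF5 held-out 276/276 (k = 1: 86, 2: 95, 3: 95) even and ≥ 0; direct equality test C-O6-G16-EQ (3-descent over ℚ(ζ₉)⁺ on the 20 island rows with e₁^{an} = 2) NOT RUN — instrument want I-O6-SHA-K1]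
[cite: Kato2004Asterisque, Conj. 12.10 (p. 224) and Thm. 12.5 (pp. 221–222)] [cite: Pollack2005, §2 (the descent template)] -/
@[conjecture] def TowerDescentOfKMCThree : Prop :=
  ∀ (W : WeierstrassCurve ℚ) [W.IsElliptic] [W.IsGloballyMinimal] (D : SignedFloorDatum W) (T : LocalTowerDatum W),
    ClassO6 W 3 → Kato2004.ImageContainsSL2 W 3 → KPHypothesesThree W →
    real W D → realT W T → (∀ k, 1 ≤ k → T.condExpAt k ≠ 0) → KMC W 3 →
      ∀ {κ : ZpExtension ℚ 3}, κ.IsCyclotomic → ∀ (ν₀ : ℤ) (ν : ℕ → ℚ) (exitOrd : ℕ → ℕ) (n : ℕ),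
        IsLevelZeroValuationThree W ν₀ → (∀ k, 1 ≤ k → k ≤ n → D.nu k true = some (ν k)) →
          ∃ e : ℕ, (e : ℚ) = katoLocalIndexAn (ν₀ : ℚ) ν T (fun _ => 0) exitOrd n ∧
            Nat.card (W.selmerLayer κ n) = 3 ^ e

/-- **T-O6-G16 (iii) `KMCOfTowerBSDThree` — the CONVERSE (THEOREM-CANDIDATE given (i)'s inputs; `@[conjecture]`;
EVIDENCE-labelled by the same census).** On a CORE row with NV_n and equality `#Sel_{3^∞}(W/k_n) = 3^{e_n^{an}}` for ALL
`n ≥ n₀`: KMC₃(W). Sketch (memo §2.3 (iii)): if `h = char(𝐇¹/Z)/char(𝐇²)` is a non-unit then `Σ_{χ∈Ĝ_n} ord₃ h(χ) ≥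
min(μ(h)3^n, λ(h)·n) → ∞`, contradicting a bounded (here zero) defect. Why it might fail: only with the inputs of (i).
[evidence: census cell O6 — structural; no numeric test possible without I-O6-SHA-K1]
[cite: Kato2004Asterisque, Thm. 12.5 (4) and Conj. 12.10] -/
@[conjecture] def KMCOfTowerBSDThree : Prop :=
  ∀ (W : WeierstrassCurve ℚ) [W.IsElliptic] [W.IsGloballyMinimal] (D : SignedFloorDatum W) (T : LocalTowerDatum W),
    ClassO6 W 3 → Kato2004.ImageContainsSL2 W 3 → KPHypothesesThree W →
    real W D → realT W T → (∀ k, 1 ≤ k → T.condExpAt k ≠ 0) →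
      ∀ {κ : ZpExtension ℚ 3}, κ.IsCyclotomic → ∀ (ν₀ : ℤ) (ν : ℕ → ℚ) (exitOrd : ℕ → ℕ) (n₀ : ℕ),
        IsLevelZeroValuationThree W ν₀ → (∀ k, 1 ≤ k → D.nu k true = some (ν k)) →
        (∀ n, n₀ ≤ n → ∃ e : ℕ, (e : ℚ) = katoLocalIndexAn (ν₀ : ℚ) ν T (fun _ => 0) exitOrd n ∧
            Nat.card (W.selmerLayer κ n) = 3 ^ e) →
          KMC W 3

/-- **PAYOFF (PROVED assembly, everything conjectural NAMED): KMC₃ + STAB + (F)(D)(C) ⟹ the Ш-GROWTH LAW (G) for the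
Selmer orders along the tower.** On a persistent CORE row of a 3-surjective, locally reducible (`D.shape ≠ IRR`), `j ≠ 0`
curve `W ∈ O6` with all even character parts non-vanishing: under `TowerDescentOfKMCThree KMC` (with `KMC W 3`), STAB and the
three tower laws, the exponents `e_n` with `#Sel_{3^∞}(W/k_n) = 3^{e_n}` satisfy `e_n = (ℓ(τ) − v₃(Δ_min)/12)·3^n + γ·n + β +
δ·(−1)^n` for all large `n` — law (G) with `α = μ_w(τ)`, assembled in the kernel from `shaGrowthLaw_of_stability_of_towerLaws`
and `threeBSDTowerBookkeeping_katoLocalIndexAn`. Nothing is credited: KMC, STAB, (F), (D), (C), `real`, `realT` are hypotheses.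
[folklore] -/
theorem shaGrowthLaw_of_towerDescent (hKMC : TowerDescentOfKMCThree KMC real realT)
    (hS : AnalyticStabilityLawThree real) (hF : CondExpTowerLawThree realT) (hDlaw : DiscriminantTowerLawThree realT)
    (hC : TamagawaTowerLawThree realT)
    (W : WeierstrassCurve ℚ) [W.IsElliptic] [W.IsGloballyMinimal] (D : SignedFloorDatum W) (T : LocalTowerDatum W)
    (hO : ClassO6 W 3) (hf : condExp W 3 = 3 ∨ condExp W 3 = 4 ∨ condExp W 3 = 5) (hSL : Kato2004.ImageContainsSL2 W 3)
    (hKP : KPHypothesesThree W) (hD : real W D) (hT : realT W T) (hadd : ∀ k, 1 ≤ k → T.condExpAt k ≠ 0) (hkmc : KMC W 3)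
    (hsurj : W.HasSurjectiveModNGaloisRep 3) (hred : D.shape ≠ .IRR) (hj : W.j ≠ 0)
    {κ : ZpExtension ℚ 3} (hκ : κ.IsCyclotomic) (ν₀ : ℤ) (ν : ℕ → ℚ) (exitOrd : ℕ → ℕ)
    (hν₀ : IsLevelZeroValuationThree W ν₀) (hNV : ∀ k, 1 ≤ k → D.nu k true = some (ν k)) :
    ∃ (k₂ : ℕ) (γ β δ : ℚ), ∀ n, k₂ ≤ n → ∃ e : ℕ, Nat.card (W.selmerLayer κ n) = 3 ^ e ∧
      (e : ℚ) = (cellLevel (condExp W 3) (W.kodairaSymbolAt (placeOf 3)) -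
        (padicValInt 3 W.minimalDiscriminantInt : ℚ) / 12) * 3 ^ n + γ * n + β + δ * (-1) ^ n := by
  -- e^{an} obeys the bookkeeping schema with r = 0 from layer 2 on (layers ≥ 1 additive, NV from layer 1)
  have hbook : ThreeBSDTowerBookkeeping (katoLocalIndexAn (ν₀ : ℚ) ν T (fun _ => 0) exitOrd) ν D T 0 2 :=
    threeBSDTowerBookkeeping_katoLocalIndexAn (ν₀ : ℚ) ν D T exitOrd 2 (by norm_num)
      (fun k hk => hadd k (by omega)) (fun k hk => hNV k (by omega))
  obtain ⟨k₂, γ, β, δ, hG⟩ := shaGrowthLaw_of_stability_of_towerLaws real realT hS hF hDlaw hC W D T hO hf hD hT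
    hsurj hred hj (katoLocalIndexAn (ν₀ : ℚ) ν T (fun _ => 0) exitOrd) ν 0 2 hbook
  refine ⟨k₂, γ, β, δ, fun n hn => ?_⟩
  obtain ⟨e, he, hcard⟩ :=
    hKMC W D T hO hSL hKP hD hT hadd hkmc hκ ν₀ ν exitOrd n hν₀ (fun k hk _ => hNV k hk)
  exact ⟨e, hcard, by rw [he]; exact hG n hn⟩

end TowerDescent

end Summit.BirchSwinnertonDyer.Rank1Residual.O6

end
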